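import Mathlib
import Literature.LinearAlgebra.Alternating.WedgeWordsBasis
import Literature.LinearAlgebra.Alternating.LefschetzCAR
import Summits.HodgeConjecture.HodgeConjecture.Theorems.TropicalKugaSatakeCayleyCayleyHodgeRankTwoCuspForms

/-!
# Route `TropicalKugaSatakeCayley`, support S5 `CayleyHodgeRankTwo` (stmt-HodgeConjecture-18573) — part B9:
# independence of the two `(6,6)`-forms `L⁴(θ²-table)` and `L⁴(Cayley table)`

The two `(6,6)`-forms of S5 are the images of the `(2,2)`-tables `tkcTheta22`, `tkcCayley22` (part B3)
under the fourth power of the Lefschetz operator `L = tkcLef` (`L η = Σᵢ e^i ∧ f^i ∧ η`). This file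
proves that they are `ℂ`-linearly independent (`tkc_lef4_tables_indep`, in the pointwise form consumed by
the assembly), in three steps:

* the tables are independent: evaluated on the frame words `(0,1,8,9)` and `(0,1,10,13)` they give
  `(1, 0)` and `(0, -8)` (`tkc_table_apply_vec_strictMono` — the value of an integral table on an
  increasing frame word is the integer `Σ_{t : word t = v} coef t`, computed by `decide`);
* `L` is additive and `ℂ`-homogeneous (pointwise: `tkcLef_add`, `tkcLef_smul_apply`);
* **pointwise hard Lefschetz** (`Literature…LefschetzCAR.eq_zero_of_iterate_lefschetz_eq_zero`, Voisin
  Lemma 6.20): on the `16`-dimensional `Λ_ℝ` with the split coordinate frame (`e^i, f^i`; `b_i, b'_i`),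
  `L⁴ : Λ⁴ → Λ¹²` is injective (`4 + 4 = 8`), so a vanishing combination of the `L⁴`-images forces the
  same combination of the tables to vanish.

Theorems only: no definition, no named fact, no sorry.

## References

* [Voisin2002] C. Voisin, Hodge Theory and Complex Algebraic Geometry I (2002), §6.2, Lemma 6.20.
* [vanGeemenVerra2003QuaternionicPryms] B. van Geemen, A. Verra, Quaternionic Pryms and Hodge classes,
  Topology 42 (2003), Cor. 6.5 (`dim B² = dim B⁶ = 6`).
-/

noncomputable section

set_option linter.dupNamespace false

namespace Summit.HodgeConjecture.HodgeConjecture.Theorems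

open Literature.LinearAlgebra.Alternating

/-! ### The split coordinate frame `(e^i, f^i; b_i, b'_i)` indexed by `Fin 8` -/

/-- `e^c (b_a) = δ_{ca}`. [folklore] -/
theorem tkc_frame_castAdd_vec_castAdd (c a : Fin 8) :
    tkcFrame (Fin.castAdd 8 c) (tkcVec (Fin.castAdd 8 a)) = if c = a then (1 : ℝ) else 0 := by
  rw [tkcFrame_tkcVec]
  by_cases h : c = a
  · rw [if_pos h, if_pos (by rw [h])]
  · rw [if_neg h, if_neg]
    intro h'
    apply h
    ext
    have h'' := congrArg Fin.val h'
    simpa [Fin.val_castAdd] using h''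

/-- `f^c (b'_a) = δ_{ca}`. [folklore] -/
theorem tkc_frame_natAdd_vec_natAdd (c a : Fin 8) :
    tkcFrame (Fin.natAdd 8 c) (tkcVec (Fin.natAdd 8 a)) = if c = a then (1 : ℝ) else 0 := by
  rw [tkcFrame_tkcVec]
  by_cases h : c = a
  · rw [if_pos h, if_pos (by rw [h])]
  · rw [if_neg h, if_neg]
    intro h'
    apply h
    ext
    have h'' := congrArg Fin.val h'
    simpa [Fin.val_natAdd] using h''

/-- `e^c (b'_a) = 0`. [folklore] -/
theorem tkc_frame_castAdd_vec_natAdd (c a : Fin 8) :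
    tkcFrame (Fin.castAdd 8 c) (tkcVec (Fin.natAdd 8 a)) = 0 := by
  rw [tkcFrame_tkcVec, if_neg]
  intro h
  have h' := congrArg Fin.val h
  simp only [Fin.val_castAdd, Fin.val_natAdd] at h'
  omega

/-- `f^c (b_a) = 0`. [folklore] -/
theorem tkc_frame_natAdd_vec_castAdd (c a : Fin 8) :
    tkcFrame (Fin.natAdd 8 c) (tkcVec (Fin.castAdd 8 a)) = 0 := by
  rw [tkcFrame_tkcVec, if_neg]
  intro h
  have h' := congrArg Fin.val h
  simp only [Fin.val_castAdd, Fin.val_natAdd] at h'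
  omega

/-- Completeness of the split frame: `Σ_c (e^c ⊗ b_c + f^c ⊗ b'_c) = id`. [folklore] -/
theorem tkc_frame_split_sum :
    ∑ c : Fin 8, ((tkcFrame (Fin.castAdd 8 c)).smulRight (tkcVec (Fin.castAdd 8 c)) +
      (tkcFrame (Fin.natAdd 8 c)).smulRight (tkcVec (Fin.natAdd 8 c))) =
      ContinuousLinearMap.id ℝ (Fin 8 ⊕ Fin 8 → ℝ) := by
  rw [← tkc_sum_smulRight_frame_vec, Finset.sum_add_distrib]
  exact (Fin.sum_univ_add (fun a : Fin (8 + 8) => (tkcFrame a).smulRight (tkcVec a))).symm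

/-- The frame covectors are integral on frame vectors (`e`-part). [folklore] -/
theorem tkc_frame_castAdd_vec_int (c : Fin 8) (a : Fin 16) :
    ∃ m : ℤ, tkcFrame (Fin.castAdd 8 c) (tkcVec a) = m := by
  rw [tkcFrame_tkcVec]
  split_ifs
  · exact ⟨1, by simp⟩
  · exact ⟨0, by simp⟩

/-- The frame covectors are integral on frame vectors (`f`-part). [folklore] -/
theorem tkc_frame_natAdd_vec_int (c : Fin 8) (a : Fin 16) :
    ∃ m : ℤ, tkcFrame (Fin.natAdd 8 c) (tkcVec a) = m := by
  rw [tkcFrame_tkcVec]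
  split_ifs
  · exact ⟨1, by simp⟩
  · exact ⟨0, by simp⟩

/-! ### Values of the tables on increasing frame words -/

/-- **The value of an integral monomial table on an increasing frame word** is the integer
`Σ_{t : word t = v} coef t` (duality of increasing monomials and increasing frame words).
[cite: vanGeemenVerra2003QuaternionicPryms, Cor. 6.5] -/
theorem tkc_table_apply_vec_strictMono {m : ℕ} (word : Fin m → (Fin 4 → Fin 16)) (coef : Fin m → ℤ)
    (hword : ∀ t (a b : Fin 4), a < b → word t a < word t b) (v : Fin 4 → Fin 16)
    (hv : ∀ a b : Fin 4, a < b → v a < v b) :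
    tkcTable word coef (tkcVec ∘ v) = ((∑ t, if word t = v then coef t else 0 : ℤ) : ℂ) := by
  rw [tkcTable_eq, ContinuousAlternatingMap.sum_apply, Int.cast_sum]
  refine Finset.sum_congr rfl fun t _ => ?_
  rw [ContinuousAlternatingMap.smul_apply,
    frameWord_apply_comp_strictMono tkcFrame tkcVec tkcFrame_tkcVec (fun a b h => hword t a b h)
      (fun a b h => hv a b h)]
  split_ifs <;> simp

/-- The tables on the frame word `(0,1,8,9)`: `θ²`-table `= 1`. [folklore] -/
theorem tkc_theta22_apply_w0 : tkcTheta22 (tkcVec ∘ (![0, 1, 8, 9] : Fin 4 → Fin 16)) = 1 := by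
  rw [tkcTheta22_eq, tkc_table_apply_vec_strictMono tkcThetaWord (fun _ => 1) (by decide +kernel) _ (by decide +kernel)]
  have h : (∑ t : Fin 28, if tkcThetaWord t = (![0, 1, 8, 9] : Fin 4 → Fin 16) then
      (fun _ : Fin 28 => (1 : ℤ)) t else 0) = 1 := by decide +kernel
  rw [h, Int.cast_one]

/-- The tables on the frame word `(0,1,8,9)`: Cayley table `= 0`. [folklore] -/
theorem tkc_cayley22_apply_w0 : tkcCayley22 (tkcVec ∘ (![0, 1, 8, 9] : Fin 4 → Fin 16)) = 0 := by
  rw [tkcCayley22_eq, tkc_table_apply_vec_strictMono tkcCayleyWord tkcCayleyCoef (by decide +kernel) _ (by decide +kernel)]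
  have h : (∑ t : Fin 64, if tkcCayleyWord t = (![0, 1, 8, 9] : Fin 4 → Fin 16) then
      tkcCayleyCoef t else 0) = 0 := by decide +kernel
  rw [h, Int.cast_zero]

/-- The tables on the frame word `(0,1,10,13)`: `θ²`-table `= 0`. [folklore] -/
theorem tkc_theta22_apply_w1 : tkcTheta22 (tkcVec ∘ (![0, 1, 10, 13] : Fin 4 → Fin 16)) = 0 := by
  rw [tkcTheta22_eq, tkc_table_apply_vec_strictMono tkcThetaWord (fun _ => 1) (by decide +kernel) _ (by decide +kernel)]
  have h : (∑ t : Fin 28, if tkcThetaWord t = (![0, 1, 10, 13] : Fin 4 → Fin 16) then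
      (fun _ : Fin 28 => (1 : ℤ)) t else 0) = 0 := by decide +kernel
  rw [h, Int.cast_zero]

/-- The tables on the frame word `(0,1,10,13)`: Cayley table `= -8`. [folklore] -/
theorem tkc_cayley22_apply_w1 : tkcCayley22 (tkcVec ∘ (![0, 1, 10, 13] : Fin 4 → Fin 16)) = -8 := by
  rw [tkcCayley22_eq, tkc_table_apply_vec_strictMono tkcCayleyWord tkcCayleyCoef (by decide +kernel) _ (by decide +kernel)]
  have h : (∑ t : Fin 64, if tkcCayleyWord t = (![0, 1, 10, 13] : Fin 4 → Fin 16) then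
      tkcCayleyCoef t else 0) = -8 := by decide +kernel
  rw [h]
  push_cast
  rfl

/-- **The two tables are linearly independent** (pointwise form): a combination `s·θ²-table + t·Cayley`
vanishing at every tuple has `s = t = 0`. [cite: vanGeemenVerra2003QuaternionicPryms, Cor. 6.5] -/
theorem tkc_tables_indep (s t : ℂ) (h : ∀ u : Fin 4 → (Fin 8 ⊕ Fin 8 → ℝ), s * tkcTheta22 u + t * tkcCayley22 u = 0) :
    s = 0 ∧ t = 0 := by
  have h0 := h (tkcVec ∘ (![0, 1, 8, 9] : Fin 4 → Fin 16))
  have h1 := h (tkcVec ∘ (![0, 1, 10, 13] : Fin 4 → Fin 16))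
  rw [tkc_theta22_apply_w0, tkc_cayley22_apply_w0] at h0
  rw [tkc_theta22_apply_w1, tkc_cayley22_apply_w1] at h1
  have hs : s = 0 := by simpa using h0
  refine ⟨hs, ?_⟩
  have h1' : t * (-8) = 0 := by simpa [hs] using h1
  rcases mul_eq_zero.mp h1' with ht | h8
  · exact ht
  · norm_num at h8

/-! ### Linearity of `L` -/

section LefLinear

variable {V : Type*} [NormedAddCommGroup V] [NormedSpace ℝ V] {n : ℕ}

/-- `θ ∧ (s • η) = s • (θ ∧ η)` for complex scalars and a real covector (pointwise). [folklore] -/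
theorem tkc_wedgeOne_smul_apply (θ : V →L[ℝ] ℝ) (s : ℂ) (η : V [⋀^Fin n]→L[ℝ] ℂ) (u : Fin (n + 1) → V) :
    wedgeOne θ (s • η) u = s * wedgeOne θ η u := by
  rw [wedgeOne_apply, wedgeOne_apply, Finset.mul_sum]
  refine Finset.sum_congr rfl fun i _ => ?_
  rw [ContinuousAlternatingMap.smul_apply, zsmul_eq_mul, zsmul_eq_mul, Complex.real_smul, Complex.real_smul,
    smul_eq_mul]
  ring

end LefLinear

/-- `L` is additive. [folklore] -/
theorem tkcLef_add {n : ℕ} (η η' : (Fin 8 ⊕ Fin 8 → ℝ) [⋀^Fin n]→L[ℝ] ℂ) :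
    tkcLef (η + η') = tkcLef η + tkcLef η' := by
  rw [tkcLef_eq, tkcLef_eq, tkcLef_eq, ← Finset.sum_add_distrib]
  refine Finset.sum_congr rfl fun i _ => ?_
  rw [wedgeOne_add, wedgeOne_add]

/-- `L` is `ℂ`-homogeneous (pointwise). [folklore] -/
theorem tkcLef_smul_apply {n : ℕ} (s : ℂ) (η : (Fin 8 ⊕ Fin 8 → ℝ) [⋀^Fin n]→L[ℝ] ℂ)
    (u : Fin (n + 2) → (Fin 8 ⊕ Fin 8 → ℝ)) : tkcLef (s • η) u = s * tkcLef η u := by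
  rw [tkcLef_eq, tkcLef_eq, ContinuousAlternatingMap.sum_apply, ContinuousAlternatingMap.sum_apply,
    Finset.mul_sum]
  refine Finset.sum_congr rfl fun i _ => ?_
  rw [wedgeOne_apply, wedgeOne_apply, Finset.mul_sum]
  refine Finset.sum_congr rfl fun a _ => ?_
  rw [tkc_wedgeOne_smul_apply, zsmul_eq_mul, zsmul_eq_mul, Complex.real_smul, Complex.real_smul]
  ring

/-- `L` is `ℂ`-linear on combinations of two forms (pointwise). [folklore] -/
theorem tkcLef_comb_apply {n : ℕ} (s t : ℂ) (η η' : (Fin 8 ⊕ Fin 8 → ℝ) [⋀^Fin n]→L[ℝ] ℂ)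
    (u : Fin (n + 2) → (Fin 8 ⊕ Fin 8 → ℝ)) :
    tkcLef (s • η + t • η') u = s * tkcLef η u + t * tkcLef η' u := by
  rw [tkcLef_add, ContinuousAlternatingMap.add_apply, tkcLef_smul_apply, tkcLef_smul_apply]

/-- `L⁴` is `ℂ`-linear on combinations of two forms (pointwise). [folklore] -/
theorem tkcLef4_comb_apply {n : ℕ} (s t : ℂ) (η η' : (Fin 8 ⊕ Fin 8 → ℝ) [⋀^Fin n]→L[ℝ] ℂ)
    (u : Fin (n + 2 + 2 + 2 + 2) → (Fin 8 ⊕ Fin 8 → ℝ)) :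
    tkcLef (tkcLef (tkcLef (tkcLef (s • η + t • η')))) u =
      s * tkcLef (tkcLef (tkcLef (tkcLef η))) u + t * tkcLef (tkcLef (tkcLef (tkcLef η'))) u := by
  have h1 : tkcLef (s • η + t • η') = s • tkcLef η + t • tkcLef η' := by
    ext v
    rw [tkcLef_comb_apply, ContinuousAlternatingMap.add_apply, ContinuousAlternatingMap.smul_apply,
      ContinuousAlternatingMap.smul_apply, smul_eq_mul, smul_eq_mul]
  have h2 : tkcLef (tkcLef (s • η + t • η')) = s • tkcLef (tkcLef η) + t • tkcLef (tkcLef η') := by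
    ext v
    rw [h1, tkcLef_comb_apply, ContinuousAlternatingMap.add_apply, ContinuousAlternatingMap.smul_apply,
      ContinuousAlternatingMap.smul_apply, smul_eq_mul, smul_eq_mul]
  have h3 : tkcLef (tkcLef (tkcLef (s • η + t • η'))) =
      s • tkcLef (tkcLef (tkcLef η)) + t • tkcLef (tkcLef (tkcLef η')) := by
    ext v
    rw [h2, tkcLef_comb_apply, ContinuousAlternatingMap.add_apply, ContinuousAlternatingMap.smul_apply,
      ContinuousAlternatingMap.smul_apply, smul_eq_mul, smul_eq_mul]
  rw [h3, tkcLef_comb_apply]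

/-! ### Injectivity of `L⁴` on `4`-forms and independence of the `(6,6)`-forms -/

/-- **`L⁴` is injective on `4`-forms of `Λ_ℝ = ℝ⁸ ⊕ ℝ⁸`** (pointwise hard Lefschetz, Voisin Lemma 6.20,
with `k = 4`, `j = 4`, `d = 8`). [cite: Voisin2002, Lemma 6.20] -/
theorem tkc_lef4_injective (β₀ : (Fin 8 ⊕ Fin 8 → ℝ) [⋀^Fin 4]→L[ℝ] ℂ)
    (h : tkcLef (tkcLef (tkcLef (tkcLef β₀))) = 0) : β₀ = 0 := by
  let β : (i : ℕ) → (Fin 8 ⊕ Fin 8 → ℝ) [⋀^Fin (4 + 2 * i)]→L[ℝ] ℂ := fun i =>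
    Nat.rec (motive := fun i => (Fin 8 ⊕ Fin 8 → ℝ) [⋀^Fin (4 + 2 * i)]→L[ℝ] ℂ) β₀ (fun _ η => tkcLef η) i
  have hβ : ∀ i, β (i + 1) = ∑ a : Fin 8, wedgeOne (tkcFrame (Fin.castAdd 8 a))
      (wedgeOne (tkcFrame (Fin.natAdd 8 a)) (β i)) := fun i => rfl
  have h0 : β 0 = β₀ := rfl
  have h4 : β 4 = 0 := h
  rw [← h0]
  exact eq_zero_of_iterate_lefschetz_eq_zero (fun c => tkcFrame (Fin.castAdd 8 c))
    (fun c => tkcFrame (Fin.natAdd 8 c)) (fun c => tkcVec (Fin.castAdd 8 c)) (fun c => tkcVec (Fin.natAdd 8 c))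
    tkc_frame_castAdd_vec_castAdd tkc_frame_natAdd_vec_natAdd tkc_frame_castAdd_vec_natAdd
    tkc_frame_natAdd_vec_castAdd tkc_frame_split_sum (k := 4) (j := 4) (by simp) β hβ h4

/-- **The `(6,6)`-forms `L⁴(θ²-table)` and `L⁴(Cayley table)` are linearly independent** (pointwise
form): if `s · L⁴θ² (u) + t · L⁴κ (u) = 0` for all `u` then `s = t = 0`.
[cite: vanGeemenVerra2003QuaternionicPryms, Cor. 6.5] -/
theorem tkc_lef4_tables_indep (s t : ℂ)
    (h : ∀ u : Fin 12 → (Fin 8 ⊕ Fin 8 → ℝ),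
      s * tkcLef (tkcLef (tkcLef (tkcLef tkcTheta22))) u + t * tkcLef (tkcLef (tkcLef (tkcLef tkcCayley22))) u = 0) :
    s = 0 ∧ t = 0 := by
  have hzero : tkcLef (tkcLef (tkcLef (tkcLef (s • tkcTheta22 + t • tkcCayley22)))) = 0 := by
    ext u
    rw [tkcLef4_comb_apply]
    exact h u
  have hβ := tkc_lef4_injective _ hzero
  refine tkc_tables_indep s t fun u => ?_
  have hu := congrArg (fun f : (Fin 8 ⊕ Fin 8 → ℝ) [⋀^Fin 4]→L[ℝ] ℂ => f u) hβ
  simp only [ContinuousAlternatingMap.add_apply, ContinuousAlternatingMap.smul_apply, smul_eq_mul,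
    ContinuousAlternatingMap.coe_zero, Pi.zero_apply] at hu
  exact hu

end Summit.HodgeConjecture.HodgeConjecture.Theorems

end
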